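import Mathlib
import HarnessLib
import Summits.NavierStokesRegularity.NavierStokesRegularity.Theorems.PoloidalWindowDoorLrcModEntireQuarticMaxNecessary
import Summits.NavierStokesRegularity.NavierStokesRegularity.Theorems.PoloidalWindowDoorLrcModEntireTwistingTHFlatRidgeMixedPin
import Summits.NavierStokesRegularity.NavierStokesRegularity.Theorems.PoloidalWindowDoorLrcModEntireTwistingTHFlatRidgeThirdJet
import Summits.NavierStokesRegularity.NavierStokesRegularity.Theorems.PoloidalWindowDoorLrcModEntireTwistingTHFlatRidgeQuarticLawTools

/-!
# Item `LrcModEntire` (stmt-NavierStokesRegularity-20428) — THE FLAT SUB-CELL AT FOURTH ORDER IN SPACE–TIME: the quartic sign `σ∂_ν⁴v₂(−1,y) ≤ 0` and the pin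
# `(∂_ν²∂ₜv₂)² ≤ 8q·(3|N|/4 − σ∂ₜ²v₂)` at every flat hot point, in EVERY direction `ν`

ns-k2-port-2 g7, helper of item 20428 under LEAD ns-poloidal-K2-p3 g15 (`--supports stmt-NavierStokesRegularity-20428 --as helper`).  Memo
`Cruxes/LrcModEntire/T2B-g15.md` §17d, second half («the space–time maximum of `√(−t)θ` at `(−1, γ(s))` along the parabolic paths `h = η√|τ|·ν` gives
`(∂ₙ²θ_t)² ≤ 8q(3N/4 − θ_tt)`»), typed BY NAME and for an ARBITRARY direction `ν ∈ ℝ³` (not only the web normal): at a flat hot point `y` the weighted signed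
component `G(t,x) = √(−t)σv₂(t,x)` has a space–time maximum at `(−1,y)` whose quadratic form has the whole space `{0} × ℝ³` in its kernel (`…FlatRidgeMixedPin`) and whose
cubic form vanishes on `(0,ν)` (`…FlatRidgeThirdJet`), so the class-free QUARTIC MAXIMUM TEST `…QuarticMaxNecessary.quarticMax_necessary` applies with `p = (1,0)`,
`q = (0,ν)` (after a smooth cut-off in time, which changes nothing near `t = −1`):

* `quarticSign_of_flatHotPoint` — **`σ·(d⁴/dn⁴)|₀ v₂(−1, y + nν) ≤ 0`** (`q := −σ∂_ν⁴θ/24 ≥ 0`, the quartic coefficient of memo §17b);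
* ★ `spacetimeQuarticPin_of_flatHotPoint` — **`3b² ≤ (σθ_tt − 3|N|/4)·(σ∂_ν⁴θ)`** with `b := (d²/dn²)|₀ ∂ₜv₂(−1, y + nν)`, `θ_tt := ∂ₜ²v₂(−1,y)`;
* `spacetimeQuarticPin_of_flatHotPoint'` — the memo's form **`b² ≤ 8q(3|N|/4 − σθ_tt)`**.
Tools: `contDiff_cutoffWeighted` (the cut-off `χ(t)G` is `C⁴` on `ℝ × ℝ³`), `deriv_deriv_weighted_timeLine_of_hotPoint` (`∂ₜ²G(−1,y) = σθ_tt − 3|N|/4`),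
`iteratedFDeriv_three_apply_eq_zero`; line calculus from `…FlatRidgeQuarticLawTools`.

WHAT THIS IS NOT: not a claim about Navier–Stokes regularity and not a proof of `stub_T2bFlat`; fourth-order point inequalities for the OPEN flat sub-cell, tying the quartic
slice data to `θ_tt` (R-e currency; memo §17e: not decisive alone) (bears_on LADDER-NS N0, item 20428 / crux 19708; OPEN).
-/

set_option linter.style.longLine false
set_option linter.dupNamespace false

namespace Summit.NavierStokesRegularity.NavierStokesRegularity.Theorems.PoloidalWindowDoorLrcModEntireTwistingTHFlatRidgeQuarticPin

open Set Function Filter Topology Metric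
open scoped RealInnerProductSpace InnerProductSpace ContDiff
open Literature.Analysis Literature.Analysis.FluidPDE Literature.Analysis.UnboundedOperators
open Summit.NavierStokesRegularity.NavierStokesRegularity.Theorems
open Summit.NavierStokesRegularity.NavierStokesRegularity.Theorems.LocalSineTubeDoorProfileAlignedWindowRigidityAncient
open Summit.NavierStokesRegularity.NavierStokesRegularity.Theorems.PoloidalWindowDoorLrcModEntireRidgeWiring
open Summit.NavierStokesRegularity.NavierStokesRegularity.Theorems.PoloidalWindowDoorLrcModEntireQuarticMax
open Summit.NavierStokesRegularity.NavierStokesRegularity.Theorems.PoloidalWindowDoorLrcModEntireQuarticMaxNecessary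
open Summit.NavierStokesRegularity.NavierStokesRegularity.Theorems.PoloidalWindowDoorLrcModEntireTwistingTHFlatRidgeJet
open Summit.NavierStokesRegularity.NavierStokesRegularity.Theorems.PoloidalWindowDoorLrcModEntireTwistingTHFlatRidgeMixedPin
open Summit.NavierStokesRegularity.NavierStokesRegularity.Theorems.PoloidalWindowDoorLrcModEntireTwistingTHFlatRidgeThirdJet
open Summit.NavierStokesRegularity.NavierStokesRegularity.Theorems.PoloidalWindowDoorLrcModEntireTwistingTHFlatRidgeQuarticLawTools

/-! ### Class-free helpers -/

/-- `D³f(y) = 0` (nested currency) kills every value of `iteratedFDeriv ℝ 3 f y`. [folklore] -/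
theorem iteratedFDeriv_three_apply_eq_zero {E : Type*} [NormedAddCommGroup E] [NormedSpace ℝ E] {f : E → ℝ} {y : E}
    (h3 : fderiv ℝ (fderiv ℝ (fderiv ℝ f)) y = 0) (m : Fin 3 → E) : iteratedFDeriv ℝ 3 f y m = 0 := by
  rw [iteratedFDeriv_succ_apply_right, iteratedFDeriv_two_apply]
  change fderiv ℝ (fderiv ℝ (fderiv ℝ f)) y _ _ _ = 0
  rw [h3]
  simp

/-- The time cut-off: `χ(t) = smoothTransition(−2 − 4t)` is `1` for `t ≤ −3/4` and `0` for `t ≥ −1/2`. -/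
theorem cutoff_eq_one {t : ℝ} (ht : t ≤ -3 / 4) : Real.smoothTransition (-2 - 4 * t) = 1 :=
  Real.smoothTransition.one_of_one_le (by linarith)

/-- See `cutoff_eq_one`. -/
theorem cutoff_eq_zero {t : ℝ} (ht : -1 / 2 ≤ t) : Real.smoothTransition (-2 - 4 * t) = 0 :=
  Real.smoothTransition.zero_of_nonpos (by linarith)

variable {C : ℝ} {v : ℝ → EuclideanSpace ℝ (Fin 3) → EuclideanSpace ℝ (Fin 3)}

/-- **The cut-off weighted component `(t,x) ↦ χ(t)·√(−t)·σ·v₂(t,x)` is `C⁴` on all of `ℝ × ℝ³`** (it is the smooth `G` on `t < 0` and `0` on `t > −1/2`). -/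
theorem contDiff_cutoffWeighted (hrate : HasTypeITimeDecay C v) (hcont : ContinuousOn (uncurry v) (Iio (0 : ℝ) ×ˢ univ))
    (hmild : ∀ s t : ℝ, s < t → t < 0 → ∀ x, v t x = heatExtension (v s) (t - s) x - oseenDuhamel 1 s v v t x) (σ : ℝ) :
    ContDiff ℝ 4 (fun z : ℝ × EuclideanSpace ℝ (Fin 3) => Real.smoothTransition (-2 - 4 * z.1) * (Real.sqrt (-z.1) * (σ * v z.1 z.2 2))) := by
  have hG := isSmoothSpaceTimeOn_weighted hrate hcont hmild σ
  have hχ : ContDiff ℝ 4 (fun z : ℝ × EuclideanSpace ℝ (Fin 3) => Real.smoothTransition (-2 - 4 * z.1)) :=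
    (Real.smoothTransition.contDiff (n := 4)).comp ((contDiff_const.sub (contDiff_const.mul contDiff_fst)))
  refine contDiff_iff_contDiffAt.2 fun z => ?_
  rcases lt_or_ge z.1 0 with hz | hz
  · -- `t < 0`: product of smooth functions
    have h1 : ContDiffAt ℝ 4 (uncurry fun t x => Real.sqrt (-t) * (σ * v t x 2)) (z.1, z.2) :=
      (hG.contDiffAt isOpen_Iio hz z.2).of_le (by exact WithTop.coe_le_coe.2 le_top)
    exact hχ.contDiffAt.mul h1
  · -- `t ≥ 0 > −1/2`: the function vanishes near `z`
    have hU : {z' : ℝ × EuclideanSpace ℝ (Fin 3) | -1 / 2 < z'.1} ∈ 𝓝 z :=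
      (isOpen_lt continuous_const continuous_fst).mem_nhds (by show -1 / 2 < z.1; linarith)
    have heq : (fun z : ℝ × EuclideanSpace ℝ (Fin 3) => Real.smoothTransition (-2 - 4 * z.1) * (Real.sqrt (-z.1) * (σ * v z.1 z.2 2))) =ᶠ[𝓝 z]
        fun _ => 0 := by
      filter_upwards [hU] with z' hz'
      rw [cutoff_eq_zero (le_of_lt hz'), zero_mul]
    exact (contDiffAt_const (c := (0 : ℝ))).congr_of_eventuallyEq heq

/-- Near any point with `t < −3/4` the cut-off weighted component IS the weighted component. -/
theorem cutoffWeighted_eventuallyEq (σ : ℝ) {z : ℝ × EuclideanSpace ℝ (Fin 3)} (hz : z.1 < -3 / 4) :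
    (fun z : ℝ × EuclideanSpace ℝ (Fin 3) => Real.smoothTransition (-2 - 4 * z.1) * (Real.sqrt (-z.1) * (σ * v z.1 z.2 2))) =ᶠ[𝓝 z]
      uncurry fun t x => Real.sqrt (-t) * (σ * v t x 2) := by
  have hU : {z' : ℝ × EuclideanSpace ℝ (Fin 3) | z'.1 < -3 / 4} ∈ 𝓝 z := (isOpen_lt continuous_fst continuous_const).mem_nhds hz
  filter_upwards [hU] with z' hz'
  show Real.smoothTransition (-2 - 4 * z'.1) * (Real.sqrt (-z'.1) * (σ * v z'.1 z'.2 2)) = Real.sqrt (-z'.1) * (σ * v z'.1 z'.2 2)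
  rw [cutoff_eq_one (le_of_lt hz'), one_mul]

/-- **`∂ₜ²G(−1,y) = σ∂ₜ²v₂(−1,y) − 3|N|/4` at a hot point** (`G = √(−t)σv₂`; uses `σ∂ₜv₂(−1,y) = |N|/2`, the first-order condition in `t`). -/
theorem deriv_deriv_weighted_timeLine_of_hotPoint (hrate : HasTypeITimeDecay C v) (hcont : ContinuousOn (uncurry v) (Iio (0 : ℝ) ×ˢ univ))
    (hmild : ∀ s t : ℝ, s < t → t < 0 → ∀ x, v t x = heatExtension (v s) (t - s) x - oseenDuhamel 1 s v v t x)
    (hne : v (-1) 0 2 ≠ 0) (hhot : ∀ t < 0, ∀ x, Real.sqrt (-t) * |v t x 2| ≤ |v (-1) 0 2|)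
    {σ : ℝ} (hσN : σ * v (-1) 0 2 = |v (-1) 0 2|) {y : EuclideanSpace ℝ (Fin 3)} (hy : v (-1) y 2 = v (-1) 0 2) :
    deriv (deriv (fun s => Real.sqrt (-s) * (σ * v s y 2))) (-1) = σ * deriv (deriv (fun s => v s y 2)) (-1) - 3 * |v (-1) 0 2| / 4 := by
  have h1 : (-1 : ℝ) ∈ Iio (0 : ℝ) := by norm_num
  have hθ := isSmoothSpaceTimeOn_two hrate hcont hmild
  have hG := isSmoothSpaceTimeOn_weighted hrate hcont hmild σ
  have hmax := isLocalMax_weighted_of_hotPoint hne hhot hσN hy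
  set G : ℝ → EuclideanSpace ℝ (Fin 3) → ℝ := fun t x => Real.sqrt (-t) * (σ * v t x 2) with hGdef
  -- first order in `t`
  have hfd0 : fderiv ℝ (uncurry G) ((-1 : ℝ), y) = 0 := hmax.fderiv_eq_zero
  have ht1 : deriv (fun s => G s y) (-1) = 0 := by
    rw [hG.deriv_timeLine isOpen_Iio h1 y, hfd0]; simp
  have hpin1 : σ * deriv (fun s => v s y 2) (-1) = |v (-1) 0 2| / 2 := by
    have h := (hasDerivAt_weighted_timeLine hrate hcont hmild σ y).deriv
    change deriv (fun s => G s y) (-1) = _ at h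
    rw [ht1, hy, hσN] at h
    linarith
  -- second order in `t`
  have hU : ∀ᶠ s in 𝓝 (-1 : ℝ), s < 0 := Iio_mem_nhds (by norm_num)
  have hθt := hθ.isSmoothSpaceTimeOn_deriv isOpen_Iio
  have hder : deriv (fun s => G s y) =ᶠ[𝓝 (-1 : ℝ)]
      fun s => (-(1 / 2 : ℝ) * (Real.sqrt (-s))⁻¹) * (σ * v s y 2) + Real.sqrt (-s) * (σ * deriv (fun s' => v s' y 2) s) := by
    filter_upwards [hU] with s hs
    have hs0 : -s ≠ 0 := (neg_pos.2 hs).ne'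
    have ha : HasDerivAt (fun s : ℝ => Real.sqrt (-s)) (1 / (2 * Real.sqrt (-s)) * (-1)) s :=
      (Real.hasDerivAt_sqrt hs0).comp s (hasDerivAt_neg s)
    have ha' : HasDerivAt (fun s : ℝ => Real.sqrt (-s)) (-(1 / 2 : ℝ) * (Real.sqrt (-s))⁻¹) s :=
      ha.congr_deriv (by rw [one_div, mul_inv]; ring)
    have hk : HasDerivAt (fun s' => σ * v s' y 2) (σ * deriv (fun s' => v s' y 2) s) s :=
      (hθ.hasDerivAt_timeLine isOpen_Iio hs y).const_mul σ
    exact (ha'.fun_mul hk).deriv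
  change deriv (deriv (fun s => G s y)) (-1) = _
  rw [hder.deriv_eq]
  have ha1 : HasDerivAt (fun s : ℝ => Real.sqrt (-s)) (-(1 / 2 : ℝ)) (-1) := by
    have h := (Real.hasDerivAt_sqrt (by norm_num : -(-1 : ℝ) ≠ 0)).comp (-1) (hasDerivAt_neg (-1 : ℝ))
    refine h.congr_deriv ?_
    rw [neg_neg, Real.sqrt_one]; ring
  have ha2 : HasDerivAt (fun s : ℝ => -(1 / 2 : ℝ) * (Real.sqrt (-s))⁻¹) (-(1 / 2 : ℝ) * (1 / 2)) (-1) := by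
    have hinv := ha1.inv (by rw [neg_neg, Real.sqrt_one]; norm_num)
    have h := hinv.const_mul (-(1 / 2 : ℝ))
    refine h.congr_deriv ?_
    norm_num [Real.sqrt_one]
  have hk1 : HasDerivAt (fun s' => σ * v s' y 2) (σ * deriv (fun s' => v s' y 2) (-1)) (-1) :=
    (hθ.hasDerivAt_timeLine isOpen_Iio h1 y).const_mul σ
  have hk2 : HasDerivAt (fun s => σ * deriv (fun s' => v s' y 2) s) (σ * deriv (deriv (fun s' => v s' y 2)) (-1)) (-1) := by
    have h := hθt.hasDerivAt_timeLine isOpen_Iio h1 y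
    change HasDerivAt (fun s => deriv (fun s' => v s' y 2) s) (deriv (fun s => deriv (fun s' => v s' y 2) s) (-1)) (-1) at h
    exact h.const_mul σ
  have htot := (ha2.fun_mul hk1).fun_add (ha1.fun_mul hk2)
  rw [htot.deriv]
  simp only [neg_neg, Real.sqrt_one, inv_one, hy]
  have hσN' : σ * v (-1) 0 2 = |v (-1) 0 2| := hσN
  linear_combination (-(1 / 4 : ℝ)) * hσN' - hpin1

/-! ### The fourth-order space–time pins at a flat hot point -/

/-- ★ **THE QUARTIC SIGN AND THE SPACE–TIME QUARTIC PIN at a flat hot point, every direction `ν`.**  Hypotheses = those of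
`…FlatRidgeJet.hessian_eq_zero_of_flatHotPoint` VERBATIM.  With `θ_tt := ∂ₜ²v₂(−1,y)`, `b := (d²/dn²)|₀ ∂ₜv₂(−1, y + nν)`, `Q₄ := (d⁴/dn⁴)|₀ σv₂(−1, y + nν)`:
`Q₄ ≤ 0` and `3b² ≤ (σθ_tt − 3|N|/4)·Q₄`. -/
theorem spacetimeQuarticPin_of_flatHotPoint (hdec : HasTypeITimeDecay C v) (hcont : ContinuousOn (uncurry v) (Iio (0 : ℝ) ×ˢ univ))
    (hmild : ∀ s t : ℝ, s < t → t < 0 → ∀ x, v t x = heatExtension (v s) (t - s) x - oseenDuhamel 1 s v v t x)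
    (hdiv : ∀ t < 0, VectorCalculus.IsDivFree (v t))
    (hTH : ∀ t < 0, ∀ x x' : EuclideanSpace ℝ (Fin 3), x 2 = x' 2 → ∀ b c : Fin 3, b ≠ 2 → c ≠ 2 →
      fderiv ℝ (v t) x (EuclideanSpace.single 2 1) b * fderiv ℝ (v t) x' (EuclideanSpace.single c 1) 2 =
        fderiv ℝ (v t) x' (EuclideanSpace.single 2 1) c * fderiv ℝ (v t) x (EuclideanSpace.single b 1) 2)
    (hne : v (-1) 0 2 ≠ 0) (hhot : ∀ t < 0, ∀ x, Real.sqrt (-t) * |v t x 2| ≤ |v (-1) 0 2|)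
    (hproper : ∀ y ∈ {y : EuclideanSpace ℝ (Fin 3) | y 2 = 0 ∧ v (-1) y 2 = v (-1) 0 2}, ∀ r : ℝ, 0 < r →
      ∃ y' : EuclideanSpace ℝ (Fin 3), y' 2 = 0 ∧ dist y' y < r ∧ v (-1) y' 2 ≠ v (-1) 0 2)
    {σ : ℝ} (hσN : σ * v (-1) 0 2 = |v (-1) 0 2|)
    {y : EuclideanSpace ℝ (Fin 3)} (hy0 : y 2 = 0) (hy : v (-1) y 2 = v (-1) 0 2)
    (hflat : fderiv ℝ (fderiv ℝ (fun x => σ * v (-1) x 2)) y (EuclideanSpace.single 0 1) (EuclideanSpace.single 0 1) +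
      fderiv ℝ (fderiv ℝ (fun x => σ * v (-1) x 2)) y (EuclideanSpace.single 1 1) (EuclideanSpace.single 1 1) = 0)
    (ν : EuclideanSpace ℝ (Fin 3)) :
    iteratedDeriv 4 (fun n : ℝ => σ * v (-1) (y + n • ν) 2) 0 ≤ 0 ∧
      3 * (iteratedDeriv 2 (fun n : ℝ => deriv (fun s => v s (y + n • ν) 2) (-1)) 0) ^ 2 ≤
        (σ * deriv (deriv (fun s => v s y 2)) (-1) - 3 * |v (-1) 0 2| / 4) * iteratedDeriv 4 (fun n : ℝ => σ * v (-1) (y + n • ν) 2) 0 := by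
  have h1 : (-1 : ℝ) ∈ Iio (0 : ℝ) := by norm_num
  have hσ0 : σ ≠ 0 := by
    intro h; rw [h, zero_mul] at hσN; exact (abs_pos.2 hne).ne' hσN.symm |>.elim
  have hθ := isSmoothSpaceTimeOn_two hdec hcont hmild
  have hG := isSmoothSpaceTimeOn_weighted hdec hcont hmild σ
  have hmax := isLocalMax_weighted_of_hotPoint hne hhot hσN hy
  set G : ℝ → EuclideanSpace ℝ (Fin 3) → ℝ := fun t x => Real.sqrt (-t) * (σ * v t x 2) with hGdef
  set z₀ : ℝ × EuclideanSpace ℝ (Fin 3) := ((-1 : ℝ), y) with hz₀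
  -- the cut-off and the recentred function `g`
  set Gc : ℝ × EuclideanSpace ℝ (Fin 3) → ℝ := fun z => Real.smoothTransition (-2 - 4 * z.1) * (Real.sqrt (-z.1) * (σ * v z.1 z.2 2)) with hGc
  have hGc4 : ContDiff ℝ 4 Gc := contDiff_cutoffWeighted hdec hcont hmild σ
  have hGceq : ∀ z : ℝ × EuclideanSpace ℝ (Fin 3), z.1 < -3 / 4 → Gc =ᶠ[𝓝 z] uncurry G := fun z hz => cutoffWeighted_eventuallyEq σ hz
  set g : ℝ × EuclideanSpace ℝ (Fin 3) → ℝ := fun z => Gc (z₀ + z) with hgdef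
  have hg4 : ContDiff ℝ 4 g := hGc4.comp (contDiff_const.add contDiff_id)
  set p : ℝ × EuclideanSpace ℝ (Fin 3) := ((1 : ℝ), (0 : EuclideanSpace ℝ (Fin 3))) with hp
  set q : ℝ × EuclideanSpace ℝ (Fin 3) := ((0 : ℝ), ν) with hq
  have hz₀1 : z₀.1 < -3 / 4 := by show (-1 : ℝ) < -3 / 4; norm_num
  -- local maximum of `g` at `0`
  have hgmax : IsLocalMax g 0 := by
    have hGcmax : IsLocalMax Gc z₀ := hmax.congr (hGceq z₀ hz₀1).symm
    have h : IsLocalMax Gc ((fun z : ℝ × EuclideanSpace ℝ (Fin 3) => z₀ + z) 0) := by simpa using hGcmax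
    exact IsLocalMax.comp_continuous (g := fun z : ℝ × EuclideanSpace ℝ (Fin 3) => z₀ + z) (b := 0) h
      (continuous_const.add continuous_id).continuousAt
  -- second derivatives of `g` at `0` are those of `uncurry G` at `z₀`
  have hD2g : iteratedFDeriv ℝ 2 g 0 = iteratedFDeriv ℝ 2 (uncurry G) z₀ := by
    have h := iteratedFDeriv_comp_add_left (f := Gc) (𝕜 := ℝ) 2 z₀ (0 : ℝ × EuclideanSpace ℝ (Fin 3))
    change iteratedFDeriv ℝ 2 g 0 = _ at h
    rw [h, add_zero]
    exact ((hGceq z₀ hz₀1).iteratedFDeriv (𝕜 := ℝ) 2).eq_of_nhds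
  -- the kernel `(0, ν)` of the space–time Hessian at a flat hot point
  set B := fderiv ℝ (fderiv ℝ (uncurry G)) z₀ with hB
  have hsym : ∀ u u', B u u' = B u' u := fun u u' => hG.isSymmSndFDerivAt isOpen_Iio h1 y u u'
  have hneg : ∀ d, B d d ≤ 0 := fun d => spacetimeHessian_weighted_nonpos_of_hotPoint hdec hcont hmild hne hhot hσN hy d
  have hslice : G (-1) = fun x => σ * v (-1) x 2 := by
    funext x
    show Real.sqrt (-(-1 : ℝ)) * (σ * v (-1) x 2) = σ * v (-1) x 2
    rw [neg_neg, Real.sqrt_one, one_mul]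
  have hf2 : ContDiff ℝ 2 (fun x => σ * v (-1) x 2) := by
    rw [← hslice]; exact (hG.contDiff_slice h1).of_le (by exact WithTop.coe_le_coe.2 le_top)
  have he : B ((0 : ℝ), ν) ((0 : ℝ), ν) = 0 := by
    rw [hB, ← fderiv_fderiv_slice_apply hG isOpen_Iio h1 y ν ν, hslice, ← fderiv_fderiv_eq_coord hf2 y ν ν]
    exact hessian_eq_zero_of_flatHotPoint hdec hcont hmild hdiv hTH hne hhot hproper hσN hy0 hy hflat ν ν
  have hker : ∀ w : ℝ × EuclideanSpace ℝ (Fin 3), iteratedFDeriv ℝ 2 g 0 ![q, w] = 0 := by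
    intro w
    rw [hD2g, iteratedFDeriv_two_apply]
    exact bilin_apply_eq_zero_of_nonpos B hsym hneg he w
  -- the line `n ↦ g (n • q)` is the signed slice along `y + nν`
  have hpt : ∀ n : ℝ, z₀ + n • q = ((-1 : ℝ), y + n • ν) := by
    intro n; ext <;> simp [hz₀, hq]
  have hline : (fun n : ℝ => g (n • q)) = fun n => σ * v (-1) (y + n • ν) 2 := by
    funext n
    show Gc (z₀ + n • q) = _
    rw [hpt n]
    show Real.smoothTransition (-2 - 4 * (-1 : ℝ)) * (Real.sqrt (-(-1 : ℝ)) * (σ * v (-1) (y + n • ν) 2)) = σ * v (-1) (y + n • ν) 2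
    rw [cutoff_eq_one (by norm_num), neg_neg, Real.sqrt_one, one_mul, one_mul]
  -- the cubic condition
  have hf3 : ContDiff ℝ 3 (fun x => σ * v (-1) x 2) := by
    rw [← hslice]; exact (hG.contDiff_slice h1).of_le (by exact WithTop.coe_le_coe.2 le_top)
  have h3 : iteratedFDeriv ℝ 3 g 0 (fun _ => q) = 0 := by
    rw [← iteratedDeriv_line (hg4.of_le (by norm_num)) q (le_refl 3), hline]
    have h := iteratedDeriv_line (g := fun x => σ * v (-1) (y + x) 2) (n := 3) (hf3.comp (contDiff_const.add contDiff_id)) ν (le_refl 3)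
    change iteratedDeriv 3 (fun n : ℝ => σ * v (-1) (y + n • ν) 2) 0 = _ at h
    rw [h, iteratedFDeriv_comp_add_left (f := fun x => σ * v (-1) x 2) 3 y 0, add_zero]
    exact iteratedFDeriv_three_apply_eq_zero
      (thirdDeriv_signed_eq_zero_of_flatHotPoint hdec hcont hmild hdiv hTH hne hhot hproper hσN hy0 hy hflat) _
  -- the class-free quartic test
  obtain ⟨hA, hQ, hdisc⟩ := quarticMax_necessary hg4 p q hgmax hker h3
  -- translate `Q`
  have hQeq : iteratedFDeriv ℝ 4 g 0 (fun _ => q) = iteratedDeriv 4 (fun n : ℝ => σ * v (-1) (y + n • ν) 2) 0 := by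
    rw [← iteratedDeriv_line hg4 q (le_refl 4), hline]
  -- translate `A`
  have hAeq : iteratedFDeriv ℝ 2 g 0 ![p, p] = σ * deriv (deriv (fun s => v s y 2)) (-1) - 3 * |v (-1) 0 2| / 4 := by
    rw [hD2g, iteratedFDeriv_two_apply, Matrix.cons_val_zero, Matrix.cons_val_one]
    change fderiv ℝ (fderiv ℝ (uncurry G)) z₀ p p = _
    rw [hp, ← deriv_deriv_timeLine hG isOpen_Iio h1 y]
    exact deriv_deriv_weighted_timeLine_of_hotPoint hdec hcont hmild hne hhot hσN hy
  -- translate `B`: the line of time derivatives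
  have hBline : (fun n : ℝ => fderiv ℝ g (n • q) p) =
      fun n => σ * deriv (fun s => v s (y + n • ν) 2) (-1) - (1 / 2 : ℝ) * (σ * v (-1) (y + n • ν) 2) := by
    funext n
    have hc : fderiv ℝ g (n • q) = fderiv ℝ Gc (z₀ + n • q) := fderiv_comp_add_left z₀
    rw [hc, hpt n]
    have hlt : ((-1 : ℝ), y + n • ν).1 < -3 / 4 := by show (-1 : ℝ) < -3 / 4; norm_num
    rw [(hGceq _ hlt).fderiv_eq, hp, ← hG.deriv_timeLine isOpen_Iio h1 (y + n • ν)]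
    exact (hasDerivAt_weighted_timeLine hdec hcont hmild σ (y + n • ν)).deriv
  -- the two line functions are smooth
  have hθ1 : ContDiff ℝ 2 (fun n : ℝ => v (-1) (y + n • ν) 2) :=
    ((hθ.contDiff_slice h1).of_le (by exact WithTop.coe_le_coe.2 le_top)).comp (contDiff_const.add (contDiff_id.smul contDiff_const))
  have hθt1 : ContDiff ℝ 2 (fun n : ℝ => deriv (fun s => v s (y + n • ν) 2) (-1)) := by
    have h := ((hθ.isSmoothSpaceTimeOn_deriv isOpen_Iio).contDiff_slice h1).of_le (by exact WithTop.coe_le_coe.2 le_top : (2 : WithTop ℕ∞) ≤ ∞)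
    exact h.comp (contDiff_const.add (contDiff_id.smul contDiff_const))
  have hθline2 : iteratedDeriv 2 (fun n : ℝ => v (-1) (y + n • ν) 2) 0 = 0 := by
    have hθ2 : ContDiff ℝ 2 (fun x => (v (-1) x 2 : ℝ)) := contDiff_two_component hdec hcont hmild
    rw [iteratedDeriv_two_line_apply hθ2 y ν, hessian_two_eq_zero_of_flatHotPoint hdec hcont hmild hdiv hTH hne hhot hproper hσN hy0 hy hflat]
    simp
  have hBeq : iteratedDeriv 2 (fun n : ℝ => fderiv ℝ g (n • q) p) 0 = σ * iteratedDeriv 2 (fun n : ℝ => deriv (fun s => v s (y + n • ν) 2) (-1)) 0 := by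
    rw [hBline]
    have e1 : (fun n : ℝ => σ * deriv (fun s => v s (y + n • ν) 2) (-1) - (1 / 2 : ℝ) * (σ * v (-1) (y + n • ν) 2)) =
        (fun n : ℝ => σ * deriv (fun s => v s (y + n • ν) 2) (-1)) - fun n : ℝ => (σ / 2) * v (-1) (y + n • ν) 2 := by
      funext n; simp only [Pi.sub_apply]; ring
    rw [e1, iteratedDeriv_sub (hθt1.contDiffAt.const_smul σ |>.congr_of_eventuallyEq (by simp [smul_eq_mul]))
      (hθ1.contDiffAt.const_smul (σ / 2) |>.congr_of_eventuallyEq (by simp [smul_eq_mul])),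
      iteratedDeriv_const_mul σ hθt1.contDiffAt, iteratedDeriv_const_mul (σ / 2) hθ1.contDiffAt, hθline2]
    ring
  rw [hQeq] at hQ hdisc
  rw [hAeq, hBeq] at hdisc
  have hσ2 : σ ^ 2 = 1 := by
    have h := abs_sigma_eq_one hne hσN
    have := sq_abs σ; rw [h] at this; linarith
  refine ⟨hQ, ?_⟩
  have e : 3 * (σ * iteratedDeriv 2 (fun n : ℝ => deriv (fun s => v s (y + n • ν) 2) (-1)) 0) ^ 2 =
      3 * (iteratedDeriv 2 (fun n : ℝ => deriv (fun s => v s (y + n • ν) 2) (-1)) 0) ^ 2 := by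
    rw [mul_pow, hσ2, one_mul]
  rw [e] at hdisc
  exact hdisc

/-- **THE QUARTIC SIGN at a flat hot point:** `σ·(d⁴/dn⁴)|₀ v₂(−1, y + nν) ≤ 0` for every direction `ν` (the quartic coefficient `q = −σ∂_ν⁴θ/24` of memo §17b is `≥ 0`). -/
theorem quarticSign_of_flatHotPoint (hdec : HasTypeITimeDecay C v) (hcont : ContinuousOn (uncurry v) (Iio (0 : ℝ) ×ˢ univ))
    (hmild : ∀ s t : ℝ, s < t → t < 0 → ∀ x, v t x = heatExtension (v s) (t - s) x - oseenDuhamel 1 s v v t x)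
    (hdiv : ∀ t < 0, VectorCalculus.IsDivFree (v t))
    (hTH : ∀ t < 0, ∀ x x' : EuclideanSpace ℝ (Fin 3), x 2 = x' 2 → ∀ b c : Fin 3, b ≠ 2 → c ≠ 2 →
      fderiv ℝ (v t) x (EuclideanSpace.single 2 1) b * fderiv ℝ (v t) x' (EuclideanSpace.single c 1) 2 =
        fderiv ℝ (v t) x' (EuclideanSpace.single 2 1) c * fderiv ℝ (v t) x (EuclideanSpace.single b 1) 2)
    (hne : v (-1) 0 2 ≠ 0) (hhot : ∀ t < 0, ∀ x, Real.sqrt (-t) * |v t x 2| ≤ |v (-1) 0 2|)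
    (hproper : ∀ y ∈ {y : EuclideanSpace ℝ (Fin 3) | y 2 = 0 ∧ v (-1) y 2 = v (-1) 0 2}, ∀ r : ℝ, 0 < r →
      ∃ y' : EuclideanSpace ℝ (Fin 3), y' 2 = 0 ∧ dist y' y < r ∧ v (-1) y' 2 ≠ v (-1) 0 2)
    {σ : ℝ} (hσN : σ * v (-1) 0 2 = |v (-1) 0 2|)
    {y : EuclideanSpace ℝ (Fin 3)} (hy0 : y 2 = 0) (hy : v (-1) y 2 = v (-1) 0 2)
    (hflat : fderiv ℝ (fderiv ℝ (fun x => σ * v (-1) x 2)) y (EuclideanSpace.single 0 1) (EuclideanSpace.single 0 1) +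
      fderiv ℝ (fderiv ℝ (fun x => σ * v (-1) x 2)) y (EuclideanSpace.single 1 1) (EuclideanSpace.single 1 1) = 0)
    (ν : EuclideanSpace ℝ (Fin 3)) :
    σ * iteratedDeriv 4 (fun n : ℝ => v (-1) (y + n • ν) 2) 0 ≤ 0 := by
  have h := (spacetimeQuarticPin_of_flatHotPoint hdec hcont hmild hdiv hTH hne hhot hproper hσN hy0 hy hflat ν).1
  rwa [iteratedDeriv_const_mul_field] at h

/-- **THE SPACE–TIME QUARTIC PIN, memo form:** with `q := −σ·(d⁴/dn⁴)|₀ v₂(−1, y + nν)/24 ≥ 0` and `b := (d²/dn²)|₀ ∂ₜv₂(−1, y + nν)`: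
`b² ≤ 8q·(3|N|/4 − σ∂ₜ²v₂(−1,y))` (T2B-g15 §17d), at every flat hot point and in every direction `ν`. -/
theorem spacetimeQuarticPin_of_flatHotPoint' (hdec : HasTypeITimeDecay C v) (hcont : ContinuousOn (uncurry v) (Iio (0 : ℝ) ×ˢ univ))
    (hmild : ∀ s t : ℝ, s < t → t < 0 → ∀ x, v t x = heatExtension (v s) (t - s) x - oseenDuhamel 1 s v v t x)
    (hdiv : ∀ t < 0, VectorCalculus.IsDivFree (v t))
    (hTH : ∀ t < 0, ∀ x x' : EuclideanSpace ℝ (Fin 3), x 2 = x' 2 → ∀ b c : Fin 3, b ≠ 2 → c ≠ 2 →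
      fderiv ℝ (v t) x (EuclideanSpace.single 2 1) b * fderiv ℝ (v t) x' (EuclideanSpace.single c 1) 2 =
        fderiv ℝ (v t) x' (EuclideanSpace.single 2 1) c * fderiv ℝ (v t) x (EuclideanSpace.single b 1) 2)
    (hne : v (-1) 0 2 ≠ 0) (hhot : ∀ t < 0, ∀ x, Real.sqrt (-t) * |v t x 2| ≤ |v (-1) 0 2|)
    (hproper : ∀ y ∈ {y : EuclideanSpace ℝ (Fin 3) | y 2 = 0 ∧ v (-1) y 2 = v (-1) 0 2}, ∀ r : ℝ, 0 < r →
      ∃ y' : EuclideanSpace ℝ (Fin 3), y' 2 = 0 ∧ dist y' y < r ∧ v (-1) y' 2 ≠ v (-1) 0 2)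
    {σ : ℝ} (hσN : σ * v (-1) 0 2 = |v (-1) 0 2|)
    {y : EuclideanSpace ℝ (Fin 3)} (hy0 : y 2 = 0) (hy : v (-1) y 2 = v (-1) 0 2)
    (hflat : fderiv ℝ (fderiv ℝ (fun x => σ * v (-1) x 2)) y (EuclideanSpace.single 0 1) (EuclideanSpace.single 0 1) +
      fderiv ℝ (fderiv ℝ (fun x => σ * v (-1) x 2)) y (EuclideanSpace.single 1 1) (EuclideanSpace.single 1 1) = 0)
    (ν : EuclideanSpace ℝ (Fin 3)) :
    (iteratedDeriv 2 (fun n : ℝ => deriv (fun s => v s (y + n • ν) 2) (-1)) 0) ^ 2 ≤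
      8 * (-(σ * iteratedDeriv 4 (fun n : ℝ => v (-1) (y + n • ν) 2) 0) / 24) * (3 * |v (-1) 0 2| / 4 - σ * deriv (deriv (fun s => v s y 2)) (-1)) := by
  have h := (spacetimeQuarticPin_of_flatHotPoint hdec hcont hmild hdiv hTH hne hhot hproper hσN hy0 hy hflat ν).2
  rw [iteratedDeriv_const_mul_field] at h
  nlinarith [h]

end Summit.NavierStokesRegularity.NavierStokesRegularity.Theorems.PoloidalWindowDoorLrcModEntireTwistingTHFlatRidgeQuarticPin
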